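import Literature.NumberTheory.Automorphic.QuadraticHeckeCharacterCMInfinityType
import Literature.NumberTheory.Automorphic.RelNormOneTorus
import Literature.AlgebraicGeometry.Motives.WeilTypeCM
import HarnessLib

/-!
# Conjugate self-dual, orthogonal and symplectic idele class characters of a CM field; weights and CM types

Topic `NumberTheory/Automorphic` (companion of `UnitaryInfinityType` — `IdeleClassGroup.HasInfinityType`,
`infinityTypeChar` —, of `QuadraticHeckeCharacterCM` — the quadratic character
`ε = quadraticClassCharCM L : C_{L⁺} →ₜ* S¹` of the CM extension `L/L⁺` —, of
`QuadraticHeckeCharacterCMInfinityType` — unitary characters of `C_L` with prescribed ∞-type and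
pull-back `ε^m` — and of `NormGroupRelNorm` / `NormGroupClosedProofs` — `classBaseChange`,
`classRelNorm`, `classGalNorm`); namespace `Literature.NumberTheory.Automorphic.IdeleClassGroup`.
Everything here is PROVED (definitions and theorems): no named facts, no instances, no `sorry`.

We instantiate the vocabulary of [Liu2021, §4.1] (Def. 4.1, Remark 4.2, Def. 4.3) on the tree's
continuous unitary idele class characters `ψ : C_L →ₜ* S¹` (`IdeleClassGroup L →ₜ* Circle`) of a CM
number field `L` with maximal totally real subfield `L⁺` (Liu's `E/F`).

AS PRINTED (arXiv:2102.11518 p. 18; `paper:arxiv-2102.11518` chunk p0018 L24–44). Def. 4.1: "We say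
that an automorphic character `μ : E^×\𝔸_E^× → ℂ^×` is conjugate self-dual if `μ` is trivial on
`N_{𝔸_E/𝔸_F} 𝔸_E^×`. We say that `μ` is conjugate orthogonal (resp. conjugate symplectic) if
`μ|_{𝔸_F^×} = 1` (resp. `μ|_{𝔸_F^×} = μ_{E/F}`)."  Remark 4.2: "A conjugate self-dual automorphic
character is necessarily strictly unitary (…). It is either conjugate orthogonal or conjugate
symplectic, but not both.  For a conjugate symplectic (resp. conjugate orthogonal) automorphic
character `μ`, there exist a CM type `Φ_μ` and a unique tuple `𝚠_μ = (𝚠_τ)_{τ ∈ Φ_F}` of odd (resp.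
even) nonnegative integers such that for every `τ ∈ Φ_F`, the component
`μ_τ : (E ⊗_{F,τ} ℝ)^× → ℂ^×` is the character `z ↦ arg(z)^{−𝚠_τ}`, where we have identified
`(E ⊗_{F,τ} ℝ)^×` with `ℂ^×` via the unique element `τ' ∈ Φ_μ` above `τ`. If `𝚠_μ` does not contain
`0`, then `Φ_μ` is also unique."  Def. 4.3: "Let `μ` be a conjugate self-dual automorphic character.
• We call `𝚠_μ` the weight of `μ`. If `𝚠_μ` is a constant `m`, then we say that `μ` is of weight `m`.
• If `𝚠_μ` does not contain zero, then we call `Φ_μ` the CM type of `μ`."  Here `arg : ℂ^× → ℂ^×` is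
"the argument character defined by the formula `arg(z) := z/√(z z̄)`" (p. 4 L26), i.e. the tree's
`Literature.Analysis.Complex.unitPart`, and `μ_{E/F}` is the quadratic character of `E/F`
(the tree's `quadraticClassCharCM L`).

DICTIONARY (tree ↔ print).  The tree records the archimedean components of `ψ` by an ∞-type
`e : InfinitePlace L → ℤ`: `HasInfinityType L ψ e` says `ψ[u] = ∏_w (u_w/|u_w|)^{e_w}` for
`u ∈ L_∞ˣ`, the coordinate `u_w ∈ ℂ` at the (complex) place `w` being read through the
distinguished embedding `w.embedding` (`infLocalUnits`, `extensionEmbedding`).  Reading the same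
component through the conjugate embedding replaces `z/|z|` by its complex conjugate, i.e. `e_w` by
`−e_w`.  Hence, for `τ = w|_{L⁺}`: `𝚠_τ = |e_w|` (`weight e w`), and the element of `Φ_μ` above `τ` is
the embedding in whose coordinate the exponent is NEGATIVE (`= −𝚠_τ < 0`): `w.embedding` if
`e_w < 0`, its conjugate if `e_w > 0` (`cmTypeOf`, through `exponentAt e φ`, the exponent of `e` in
the coordinate `φ`; `exponentAt_eq_neg_weight_of_mem`).  Liu's index set `Φ_F` (the real places of
`F = L⁺`) is in bijection with `InfinitePlace L` (Mathlib `IsCMField.equivInfinitePlace`,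
`w ↦ w|_{L⁺}`); we index by the latter.  (The `(p, q)`-∞-types of ALGEBRAIC Hecke characters
`𝕀_K →* ℂˣ`, their exponent function `HeckeCharacter.embExponent` and the type swap under `χ ∘ c`
live in `GaloisRepresentations/CMTypeHeckeCharacter`; Liu's characters are unitary — `arg^{−𝚠}`,
the tree's `HasInfinityType e` — and pass to algebraic ones by `μ^{alg} := μ · |·|_E^{−1/2}`,
[Liu2021] p. 18 L44–48, which is not used here.)

Contents.
* `IsConjugateSelfDual`, `IsConjugateOrthogonal`, `IsConjugateSymplectic` (Def. 4.1), over the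
  tree's Galois norm `classGalNorm L⁺ L : C_L →* C_L`, `[y] ↦ [y · ȳ]`
  (`isConjugateSelfDual_iff_mul_conj`: "trivial on `N 𝔸_L^× = {y ȳ}`"), base change
  `classBaseChange L⁺ L : C_{L⁺} →* C_L` ("`μ|_{𝔸_F^×}`") and `quadraticClassCharCM L` ("`μ_{E/F}`");
  `IsConjugateOrthogonal.isConjugateSelfDual`; `IsConjugateSymplectic.not_isConjugateOrthogonal`
  ("not both"); `IsConjugateSymplectic.isConjugateSelfDual_of_norm` (see NOT HERE (i) — the hypothesis
  is now a theorem of the sequel `QuadraticIdelicNormLocalNorms`, see DONE ELSEWHERE below).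
* Remark 4.2, parity — PROVED: `IsConjugateSymplectic.odd`, `IsConjugateOrthogonal.even` (the
  ∞-type of a conjugate symplectic, resp. orthogonal, character is odd, resp. even, at every place;
  test idele `⟨−1⟩_v`, `negOneBelow`), and uniqueness of the ∞-type over a CM field
  (`hasInfinityType_unique`, from `infinityType_unique_of_isComplex`).
* Def. 4.3: `weight e`, `exponentAt e φ`, `cmTypeOf L e he : Motives.CMType L` — the tree's CM
  types (`Literature/AlgebraicGeometry/Motives/WeilTypeCM`, the type consumed by the model's
  `CMCode`) —, `embedding_mem_cmTypeOf_iff`, `conjugate_embedding_mem_cmTypeOf_iff`; at the level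
  of characters the relational predicates `HasWeight L ψ 𝔴`, `HasCMType L ψ Φ` with
  `HasWeight.unique`, `HasCMType.unique` ("`Φ_μ` is also unique").
* EXISTENCE, in the form the model binder quantifies over: `exists_isConjugateSymplectic_hasCMType`
  — for every CM type `Φ` of `L` there is a conjugate symplectic `ψ : C_L →ₜ* S¹` of weight one
  (`HasWeight L ψ 1`) with CM type `Φ` — from `exists_ideleClassChar_of_isCMField_odd` (`m = 1`) with
  the ∞-type `weightOneType Φ` (`−1` at `w` if `w.embedding ∈ Φ`, else `+1`) and
  `cmTypeOf_weightOneType`.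

NOT HERE. (i) "conjugate symplectic ⇒ conjugate self-dual" needs `ε ∘ N_{L/L⁺} = 1` on `𝕀_L`, i.e.
that relative norms of ideles of `L` lie in the kernel `P_{L⁺} · normIdeles L⁺ θ` of the tree's `ε`
(O'Meara §65A, Example 65:2: `N_{L/L⁺} J_L ⊆ P · N J`); the tree does not compute the local
components of `AdeleRing.ideleRelNorm` (module docstring of `QuadraticForms/QuadraticNormIndex`), so
the implication is proved from that vanishing as an explicit hypothesis
(`IsConjugateSymplectic.isConjugateSelfDual_of_norm`) and nothing is asserted.  (ii) "strictly
unitary"; "either orthogonal or symplectic" (needs (i) and the norm index); the EXISTENCE half of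
Remark 4.2 — that a conjugate self-dual `ψ` HAS an ∞-type `e` (`ψ_w` trivial on `ℝ_{>0}`, hence a
power of `arg`): provable from the component formulas of the Galois action on `L_∞`
(`GaloisActionAdeleRing`, `InfiniteAdeleRing.smul_apply_smul`) and the classification of continuous
characters of `S¹` (`RepresentationTheory/CompactGroups/CircleCharacters`, `CircleChar.eq_zpow`), not
done here — so weights and CM types are attached RELATIONALLY (`HasWeight`, `HasCMType`: "there is
an ∞-type `e` with …", unique when it exists), and every character produced here comes with its
∞-type; `μ^c`, `μ^{alg}`, the
fields `M_μ ⊇ M'_μ`, reflex types and CM data (Def. 4.3 (2), Def. 4.5 — carriers in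
`Literature/AlgebraicGeometry/Liu2021/CMData`); Hecke-character versions `𝕀_L →* ℂˣ` (bridge:
`IdeleClassGroup.toHeckeCharacter` in `IdeleClassCharacterHecke`,
`exists_heckeCharacter_restrict_eq_quadraticHeckeCharCM` in `HeckeCharacterCMSplitting`).

DONE ELSEWHERE (sequels; this paragraph is a pointer added after they landed — the statements of this file
are unchanged).  (i) is PROVED in `QuadraticIdelicNormLocalNorms`: `range_ideleRelNorm_le_normIdeles`
(`N_{L/L⁺} 𝕀_L ≤ normIdeles L⁺ θ`, O'Meara Ex. 65:2 "⊆", from the global coordinates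
`𝔸_L = 𝔸_{L⁺} ⊕ 𝔸_{L⁺} δ` of `QuadraticAdeleBaseChange`, no local components needed),
`quadraticHeckeCharCM_ideleRelNorm` (`ε ∘ N_{L/L⁺} = 1`, exactly the hypothesis `hε` below), hence
`IsConjugateSymplectic.isConjugateSelfDual` WITHOUT `hε`; and of (ii): "either orthogonal or symplectic" is
`IsConjugateSelfDual.isConjugateOrthogonal_or_isConjugateSymplectic` / `isConjugateSelfDual_iff` there; the
EXISTENCE half of Remark 4.2 is `IsConjugateSelfDual.exists_hasInfinityType` (and the functions
`infinityType` / `weightOf` / `cmType` of Def. 4.3) in `ConjugateSelfDualInfinityType`; `μ^c = μ ∘ c`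
(Remark 4.4: conjugate symplectic of the same weight, `Φ_{μ^c} = \bar Φ_μ`) and "strictly unitary"
(Def. B.2; Remark 4.2 first sentence) in `IdeleClassCharacterConjugate`.  Still not in the tree: `μ^{alg}`,
`M_μ ⊇ M'_μ` computed from `μ`, reflex types of a character.

## References

* [Liu2021] Y. Liu, *Fourier–Jacobi cycles and arithmetic relative trace formula*, Camb. J. Math. 9
  (2021), no. 1, 1–147, arXiv:2102.11518 — §4.1: Def. 4.1, Remark 4.2, Def. 4.3; p. 4 (the character
  `arg`).
* [WeilBNT1967] A. Weil, *Basic Number Theory* (1967), Ch. VII §3 (∞-types of characters of `C_K`).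
* [Omeara1963] O. T. O'Meara, *Introduction to Quadratic Forms* (1963), §65A Example 65:2 (norm
  idèles of a quadratic extension).
-/

noncomputable section

open NumberField NumberField.InfinitePlace NumberField.InfinitePlace.Completion

namespace Literature.NumberTheory.Automorphic

open GaloisRepresentations InfiniteAdeleRing Literature.Analysis.Complex
open Literature.AlgebraicGeometry.Motives (CMType)

namespace IdeleClassGroup

/-! ## Exponents, weights and CM types of an ∞-type (Def. 4.3) -/

section Exponent

variable {K : Type*} [Field K]

open scoped Classical in
/-- The exponent of the ∞-type `e` in the coordinate `φ : K →+* ℂ`: `e_w` if `φ` is the distinguished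
embedding `w.embedding` of its place `w = mk φ`, and `−e_w` if `φ` is the conjugate embedding
(reading `z/|z|` through `φ̄` conjugates it).  In Liu's notation the exponent in the coordinate
`τ' ∈ Φ_μ` is `−𝚠_τ`. [cite: Liu2021, Remark 4.2 / Def. 4.3] -/
def exponentAt (e : InfinitePlace K → ℤ) (φ : K →+* ℂ) : ℤ :=
  if (InfinitePlace.mk φ).embedding = φ then e (InfinitePlace.mk φ) else -e (InfinitePlace.mk φ)

/-- In the distinguished coordinate the exponent is `e_w`. [folklore] -/
@[simp] theorem exponentAt_embedding (e : InfinitePlace K → ℤ) (w : InfinitePlace K) :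
    exponentAt e w.embedding = e w := by
  rw [exponentAt, mk_embedding, if_pos rfl]

/-- Passing to the conjugate coordinate changes the sign of the exponent (at a complex `φ`).
[folklore] -/
theorem exponentAt_conjugate (e : InfinitePlace K → ℤ) {φ : K →+* ℂ}
    (hφ : ¬ ComplexEmbedding.IsReal φ) :
    exponentAt e (ComplexEmbedding.conjugate φ) = -exponentAt e φ := by
  have hne : ComplexEmbedding.conjugate φ ≠ φ := fun h => hφ (ComplexEmbedding.isReal_iff.2 h)
  unfold exponentAt
  rw [mk_conjugate_eq]
  rcases embedding_mk_eq φ with h | h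
  · have h2 : (InfinitePlace.mk φ).embedding ≠ ComplexEmbedding.conjugate φ :=
      fun h' => hne (h'.symm.trans h)
    rw [if_neg h2, if_pos h]
  · have h2 : (InfinitePlace.mk φ).embedding ≠ φ := fun h' => hne (h.symm.trans h')
    rw [if_pos h, if_neg h2, neg_neg]

/-- At a complex place `w`, the exponent in the coordinate `w̄.embedding` is `−e_w`. [folklore] -/
theorem exponentAt_conjugate_embedding (e : InfinitePlace K → ℤ) {w : InfinitePlace K}
    (hw : w.IsComplex) :
    exponentAt e (ComplexEmbedding.conjugate w.embedding) = -e w := by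
  rw [exponentAt_conjugate e (isComplex_iff.1 hw), exponentAt_embedding]

/-- `|exponentAt e φ| = |e_{mk φ}|`. [folklore] -/
theorem natAbs_exponentAt (e : InfinitePlace K → ℤ) (φ : K →+* ℂ) :
    (exponentAt e φ).natAbs = (e (InfinitePlace.mk φ)).natAbs := by
  unfold exponentAt
  split_ifs <;> simp

/-- A zero-free ∞-type has non-zero exponents in every coordinate. [folklore] -/
theorem exponentAt_ne_zero {e : InfinitePlace K → ℤ} (he : ∀ w, e w ≠ 0) (φ : K →+* ℂ) :
    exponentAt e φ ≠ 0 := by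
  unfold exponentAt
  split_ifs <;> simp [he]

/-- **The weight** `𝚠` of the ∞-type `e` ([Liu2021] Def. 4.3: "We call `𝚠_μ` the weight of `μ`"):
`𝚠_w = |e_w|`, indexed by the places `w` of `K` (for a CM field, equivalently by the real places
`w|_{K⁺}` below, `IsCMField.equivInfinitePlace`). [cite: Liu2021, Def. 4.3] -/
def weight (e : InfinitePlace K → ℤ) (w : InfinitePlace K) : ℕ := (e w).natAbs

/-- Unfolding `weight`. [folklore] -/
@[simp] theorem weight_apply (e : InfinitePlace K → ℤ) (w : InfinitePlace K) :
    weight e w = (e w).natAbs := rfl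

end Exponent

section CMTypeOf

variable (L : Type) [Field L] [NumberField L] [IsCMField L]

/-- **The CM type of a zero-free ∞-type** ([Liu2021] Remark 4.2 / Def. 4.3: "If `𝚠_μ` does not contain
zero, then we call `Φ_μ` the CM type of `μ`"): the set of embeddings `φ : L →+* ℂ` in whose coordinate
the exponent is negative (`= −𝚠 < 0`), i.e. `w.embedding` for `e_w < 0` and `w̄.embedding` for
`e_w > 0`.  It is a CM type in the tree's sense (`Motives.CMType L`: exactly one of `φ, φ̄`), because
`L` is totally complex and the two exponents are `± e_w ≠ 0`. [cite: Liu2021, Def. 4.3] -/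
def cmTypeOf (e : InfinitePlace L → ℤ) (he : ∀ w, e w ≠ 0) : CMType L :=
  ⟨{φ | exponentAt e φ < 0}, fun φ => by
    simp only [Set.mem_setOf_eq]
    rw [exponentAt_conjugate e (not_isReal_of_mk_isComplex (IsTotallyComplex.isComplex _)),
      neg_lt_zero]
    have := exponentAt_ne_zero he φ
    omega⟩

variable {L}

/-- Membership in `cmTypeOf`: the exponent in the coordinate `φ` is negative. [folklore] -/
@[simp] theorem mem_cmTypeOf_iff {e : InfinitePlace L → ℤ} {he : ∀ w, e w ≠ 0} {φ : L →+* ℂ} :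
    φ ∈ (cmTypeOf L e he).1 ↔ exponentAt e φ < 0 := Iff.rfl

/-- `w.embedding ∈ Φ_e ↔ e_w < 0`. [folklore] -/
theorem embedding_mem_cmTypeOf_iff {e : InfinitePlace L → ℤ} {he : ∀ w, e w ≠ 0}
    {w : InfinitePlace L} : w.embedding ∈ (cmTypeOf L e he).1 ↔ e w < 0 := by
  rw [mem_cmTypeOf_iff, exponentAt_embedding]

/-- `w̄.embedding ∈ Φ_e ↔ 0 < e_w`. [folklore] -/
theorem conjugate_embedding_mem_cmTypeOf_iff {e : InfinitePlace L → ℤ} {he : ∀ w, e w ≠ 0}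
    {w : InfinitePlace L} :
    ComplexEmbedding.conjugate w.embedding ∈ (cmTypeOf L e he).1 ↔ 0 < e w := by
  rw [mem_cmTypeOf_iff, exponentAt_conjugate_embedding e (IsTotallyComplex.isComplex w), neg_lt_zero]

/-- **"`μ_τ` is `z ↦ arg(z)^{−𝚠_τ}` in the coordinate `τ' ∈ Φ_μ`"**: in the coordinate of a member of
the CM type the exponent is minus the weight. [cite: Liu2021, Remark 4.2] -/
theorem exponentAt_eq_neg_weight_of_mem {e : InfinitePlace L → ℤ} {he : ∀ w, e w ≠ 0}
    {φ : L →+* ℂ} (h : φ ∈ (cmTypeOf L e he).1) :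
    exponentAt e φ = -(weight e (InfinitePlace.mk φ) : ℤ) := by
  have h1 : exponentAt e φ < 0 := h
  have h2 := natAbs_exponentAt e φ
  rw [weight_apply]
  omega

end CMTypeOf

/-! ## Conjugate self-dual, orthogonal, symplectic (Def. 4.1) -/

section ConjugateSelfDual

variable (L : Type) [Field L] [NumberField L] [IsCMField L]

local notation3 "L⁺" => maximalRealSubfield L

/-- **Conjugate self-dual** ([Liu2021] Def. 4.1: "`μ` is trivial on `N_{𝔸_E/𝔸_F} 𝔸_E^×`"): `ψ ∘ N̄ = 1`
for the Galois norm `N̄ = classGalNorm L⁺ L : C_L → C_L`, `[y] ↦ [∏_σ σ • y] = [y · ȳ]`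
(`isConjugateSelfDual_iff_mul_conj`). [cite: Liu2021, Def. 4.1] -/
def IsConjugateSelfDual (ψ : IdeleClassGroup L →ₜ* Circle) : Prop :=
  ∀ c : IdeleClassGroup L, ψ (classGalNorm L⁺ L c) = 1

/-- **Conjugate orthogonal** ([Liu2021] Def. 4.1: "`μ|_{𝔸_F^×} = 1`"): `ψ` is trivial on the base
change `classBaseChange L⁺ L : C_{L⁺} → C_L` of the idele classes of `L⁺`. [cite: Liu2021, Def. 4.1] -/
def IsConjugateOrthogonal (ψ : IdeleClassGroup L →ₜ* Circle) : Prop :=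
  ∀ a : IdeleClassGroup L⁺, ψ (classBaseChange L⁺ L a) = 1

/-- **Conjugate symplectic** ([Liu2021] Def. 4.1: "`μ|_{𝔸_F^×} = μ_{E/F}`", `μ_{E/F}` "the quadratic
character associated to `E/F` via the global class field theory", p. 18 L11): the pull-back of `ψ` to
`C_{L⁺}` is the tree's quadratic character `ε = quadraticClassCharCM L : C_{L⁺} →ₜ* S¹` of `L/L⁺`
(`QuadraticHeckeCharacterCM`: the quadratic Hecke character of `L⁺(√θ) = L`, kernel
`P · normIdeles L⁺ θ`). [cite: Liu2021, Def. 4.1] -/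
def IsConjugateSymplectic (ψ : IdeleClassGroup L →ₜ* Circle) : Prop :=
  ∀ a : IdeleClassGroup L⁺, ψ (classBaseChange L⁺ L a) = quadraticClassCharCM L a

variable {L}

/-- The printed form of Def. 4.1: `ψ` is conjugate self-dual iff `ψ[y · ȳ] = 1` for every idele `y`
of `L` (`ȳ = c • y`, `c` the complex conjugation of `L/L⁺`; `ideleGalNorm_eq_mul_complexConj_smul`).
[cite: Liu2021, Def. 4.1] -/
theorem isConjugateSelfDual_iff_mul_conj (ψ : IdeleClassGroup L →ₜ* Circle) :
    IsConjugateSelfDual L ψ ↔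
      ∀ y : ideleGroup L,
        ψ ((y * IsCMField.complexConj L • y : ideleGroup L) : IdeleClassGroup L) = 1 := by
  constructor
  · intro h y
    rw [← ideleGalNorm_eq_mul_complexConj_smul L y, ← classGalNorm_mk]
    exact h _
  · intro h c
    induction c using QuotientGroup.induction_on with
    | H y => rw [classGalNorm_mk, ideleGalNorm_eq_mul_complexConj_smul L y]; exact h y

/-- `ψ` is conjugate self-dual iff `ψ ((N_{L/L⁺} c)_L) = 1` for every idele class `c` of `L`
(`classBaseChange_classRelNorm`: `(N_{L/L⁺} c)_L = N̄ c`). [folklore] -/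
theorem isConjugateSelfDual_iff_classRelNorm (ψ : IdeleClassGroup L →ₜ* Circle) :
    IsConjugateSelfDual L ψ ↔
      ∀ c : IdeleClassGroup L, ψ (classBaseChange L⁺ L (classRelNorm L⁺ L c)) = 1 := by
  simp only [IsConjugateSelfDual, classBaseChange_classRelNorm]

/-- **Conjugate orthogonal ⇒ conjugate self-dual** (`N̄ c = (N_{L/L⁺} c)_L` is a base change).
[cite: Liu2021, Def. 4.1 / Remark 4.2] -/
theorem IsConjugateOrthogonal.isConjugateSelfDual {ψ : IdeleClassGroup L →ₜ* Circle}
    (h : IsConjugateOrthogonal L ψ) : IsConjugateSelfDual L ψ :=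
  (isConjugateSelfDual_iff_classRelNorm ψ).2 fun _ => h _

/-- **Conjugate symplectic ⇒ conjugate self-dual, given `ε ∘ N_{L/L⁺} = 1`.**  The hypothesis `hε` —
the quadratic character of `L/L⁺` kills relative norms of ideles of `L` (O'Meara §65A Example 65:2,
`N_{L/L⁺} J_L ⊆ P · N J`) — is displayed here (module docstring, NOT HERE (i)); it is PROVED in the sequel
`QuadraticIdelicNormLocalNorms` (`quadraticHeckeCharCM_ideleRelNorm`), whose
`IsConjugateSymplectic.isConjugateSelfDual` is the hypothesis-free form of this theorem.
[cite: Liu2021, Remark 4.2] -/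
theorem IsConjugateSymplectic.isConjugateSelfDual_of_norm {ψ : IdeleClassGroup L →ₜ* Circle}
    (h : IsConjugateSymplectic L ψ)
    (hε : ∀ y : ideleGroup L, quadraticHeckeCharCM L (AdeleRing.ideleRelNorm L⁺ L y) = 1) :
    IsConjugateSelfDual L ψ := by
  refine (isConjugateSelfDual_iff_classRelNorm ψ).2 fun c => ?_
  induction c using QuotientGroup.induction_on with
  | H y =>
    rw [h, classRelNorm_mk, ← Circle.coe_eq_one, coe_quadraticClassCharCM_mk, hε, Units.val_one]

/-- **"… but not both"**: a conjugate symplectic character is not conjugate orthogonal (`ε ≠ 1`,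
`quadraticClassCharCM_ne_one`). [cite: Liu2021, Remark 4.2] -/
theorem IsConjugateSymplectic.not_isConjugateOrthogonal {ψ : IdeleClassGroup L →ₜ* Circle}
    (h : IsConjugateSymplectic L ψ) : ¬ IsConjugateOrthogonal L ψ := fun h' =>
  quadraticClassCharCM_ne_one L (ContinuousMonoidHom.ext fun a => by rw [← h a, h' a]; rfl)

/-! ## Remark 4.2: parity of the ∞-type -/

/-- **The ∞-type of a character of a CM field is unique** (all places are complex;
`infinityType_unique_of_isComplex`) — Liu's "a unique tuple `𝚠_μ`". [cite: WeilBNT1967, Ch. VII §3] -/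
theorem hasInfinityType_unique {ψ : IdeleClassGroup L →ₜ* Circle} {e e' : InfinitePlace L → ℤ}
    (he : HasInfinityType L ψ e) (he' : HasInfinityType L ψ e') : e = e' :=
  funext fun w => infinityType_unique_of_isComplex L ψ he he' (IsTotallyComplex.isComplex w)

variable (L) in
/-- The test idele for Remark 4.2: the infinite idele of `L⁺` which is `−1` at the (real) place
`w|_{L⁺}` below `w` and `1` at the other places. [folklore] -/
def negOneBelow (w : InfinitePlace L) : (InfiniteAdeleRing L⁺)ˣ :=
  singleUnits L⁺ (w.comap (algebraMap L⁺ L)) (-1)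

omit [IsCMField L] in
/-- The coordinate of `negOneBelow w` at `w|_{L⁺}` is `−1`. [folklore] -/
theorem coe_cmRealCoord_negOneBelow_self (w : InfinitePlace L) :
    ((cmRealCoord L (negOneBelow L w) (w.comap (algebraMap L⁺ L)) : ℝˣ) : ℝ) = -1 := by
  rw [coe_cmRealCoord, negOneBelow, singleUnits_apply_self, Units.val_neg, Units.val_one, map_neg,
    map_one]

omit [IsCMField L] in
/-- The coordinates of `negOneBelow w` away from `w|_{L⁺}` are `1`. [folklore] -/
theorem coe_cmRealCoord_negOneBelow_of_ne (w : InfinitePlace L) {v : InfinitePlace L⁺}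
    (hv : v ≠ w.comap (algebraMap L⁺ L)) :
    ((cmRealCoord L (negOneBelow L w) v : ℝˣ) : ℝ) = 1 := by
  rw [coe_cmRealCoord, negOneBelow, singleUnits_apply_of_ne _ _ _ hv, map_one]

/-- `w' ≠ w ⇒ w'|_{L⁺} ≠ w|_{L⁺}` (restriction to `L⁺` is a bijection on places of a CM field,
`IsCMField.equivInfinitePlace`). [folklore] -/
theorem comap_ne_comap_of_ne {w w' : InfinitePlace L} (hw' : w' ≠ w) :
    w'.comap (algebraMap L⁺ L) ≠ w.comap (algebraMap L⁺ L) := fun h =>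
  hw' ((IsCMField.equivInfinitePlace L).injective (by
    rw [IsCMField.equivInfinitePlace_apply, IsCMField.equivInfinitePlace_apply]; exact h))

/-- **`ε[negOneBelow w] = −1`** (`ε = sgn` at every real place of `L⁺`). [folklore] -/
theorem coe_quadraticClassCharCM_negOneBelow (w : InfinitePlace L) :
    ((quadraticClassCharCM L (infUnitsToClass L⁺ (negOneBelow L w)) : Circle) : ℂ) = -1 := by
  rw [quadraticClassCharCM_infUnitsToClass_eq_prod, ← Circle.coeHom_apply, map_prod,
    Finset.prod_eq_single (w.comap (algebraMap L⁺ L))]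
  · rw [Circle.coeHom_apply,
      coe_unitPart_ofRealUnits_of_neg _ (by rw [coe_cmRealCoord_negOneBelow_self]; norm_num)]
  · intro v _ hv
    rw [Circle.coeHom_apply,
      unitPart_ofRealUnits_of_pos _ (by rw [coe_cmRealCoord_negOneBelow_of_ne w hv]; exact one_pos),
      Circle.coe_one]
  · intro h; exact absurd (Finset.mem_univ _) h

/-- **`∏_{w'} (u_{w'}/|u_{w'}|)^{e_{w'}} = (−1)^{e_w}`** for `u` the base change of `negOneBelow w` to
`L_∞ˣ` (its coordinates are `−1` at `w` and `1` elsewhere). [folklore] -/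
theorem coe_infinityTypeChar_infiniteIdeleBaseChange_negOneBelow (e : InfinitePlace L → ℤ)
    (w : InfinitePlace L) :
    ((infinityTypeChar L e (infiniteIdeleBaseChange L⁺ L (negOneBelow L w)) : Circle) : ℂ) =
      (-1) ^ e w := by
  rw [infinityTypeChar_apply, ← Circle.coeHom_apply, map_prod, Finset.prod_eq_single w]
  · rw [Circle.coeHom_apply, Circle.coe_zpow, infLocalUnits_infiniteIdeleBaseChange_of_isCMField,
      coe_unitPart_ofRealUnits_of_neg _ (by rw [coe_cmRealCoord_negOneBelow_self]; norm_num)]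
  · intro w' _ hw'
    rw [Circle.coeHom_apply, infLocalUnits_infiniteIdeleBaseChange_of_isCMField,
      unitPart_ofRealUnits_of_pos _
        (by rw [coe_cmRealCoord_negOneBelow_of_ne w (comap_ne_comap_of_ne hw')]; exact one_pos),
      one_zpow, Circle.coe_one]
  · intro h; exact absurd (Finset.mem_univ w) h

/-- **Remark 4.2 (conjugate symplectic ⇒ odd weights)**: if `ψ` is conjugate symplectic with ∞-type
`e`, then `e_w` is odd at every place `w` (evaluate `ψ ∘ ι = ε` at `negOneBelow w`:
`(−1)^{e_w} = ε(⟨−1⟩_{w|L⁺}) = −1`). [cite: Liu2021, Remark 4.2] -/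
theorem IsConjugateSymplectic.odd {ψ : IdeleClassGroup L →ₜ* Circle} (hψ : IsConjugateSymplectic L ψ)
    {e : InfinitePlace L → ℤ} (he : HasInfinityType L ψ e) (w : InfinitePlace L) : Odd (e w) := by
  have h1 := hψ (infUnitsToClass L⁺ (negOneBelow L w))
  rw [classBaseChange_infUnitsToClass, he] at h1
  apply_fun ((↑) : Circle → ℂ) at h1
  rw [coe_infinityTypeChar_infiniteIdeleBaseChange_negOneBelow, coe_quadraticClassCharCM_negOneBelow]
    at h1
  rcases Int.even_or_odd (e w) with hev | hodd
  · rw [hev.neg_one_zpow] at h1; norm_num at h1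
  · exact hodd

/-- **Remark 4.2 (conjugate orthogonal ⇒ even weights)**: if `ψ` is conjugate orthogonal with ∞-type
`e`, then `e_w` is even at every place `w` (`(−1)^{e_w} = 1`). [cite: Liu2021, Remark 4.2] -/
theorem IsConjugateOrthogonal.even {ψ : IdeleClassGroup L →ₜ* Circle} (hψ : IsConjugateOrthogonal L ψ)
    {e : InfinitePlace L → ℤ} (he : HasInfinityType L ψ e) (w : InfinitePlace L) : Even (e w) := by
  have h1 := hψ (infUnitsToClass L⁺ (negOneBelow L w))
  rw [classBaseChange_infUnitsToClass, he] at h1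
  apply_fun ((↑) : Circle → ℂ) at h1
  rw [coe_infinityTypeChar_infiniteIdeleBaseChange_negOneBelow, Circle.coe_one] at h1
  rcases Int.even_or_odd (e w) with hev | hodd
  · exact hev
  · rw [hodd.neg_one_zpow] at h1; norm_num at h1

/-- The ∞-type of a conjugate symplectic character is zero-free (odd), so its CM type `cmTypeOf` is
defined. [cite: Liu2021, Remark 4.2] -/
theorem IsConjugateSymplectic.ne_zero {ψ : IdeleClassGroup L →ₜ* Circle}
    (hψ : IsConjugateSymplectic L ψ) {e : InfinitePlace L → ℤ} (he : HasInfinityType L ψ e)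
    (w : InfinitePlace L) : e w ≠ 0 := fun h0 => by
  have h := hψ.odd he w
  rw [h0] at h
  exact (Int.not_odd_iff_even.2 Even.zero) h

/-! ## Weight and CM type of a character (Def. 4.3), relationally -/

variable (L) in
/-- **`ψ` has weight `𝔴`** ([Liu2021] Def. 4.3): `ψ` has an ∞-type `e` with `|e_w| = 𝔴_w` for all `w`.
"Of weight `m`" is `HasWeight L ψ (fun _ => m)`; weight one is `HasWeight L ψ 1`.
[cite: Liu2021, Def. 4.3] -/
def HasWeight (ψ : IdeleClassGroup L →ₜ* Circle) (𝔴 : InfinitePlace L → ℕ) : Prop :=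
  ∃ e : InfinitePlace L → ℤ, HasInfinityType L ψ e ∧ weight e = 𝔴

variable (L) in
/-- **`ψ` has CM type `Φ`** ([Liu2021] Def. 4.3): `ψ` has a zero-free ∞-type `e` with `Φ = cmTypeOf e`.
[cite: Liu2021, Def. 4.3] -/
def HasCMType (ψ : IdeleClassGroup L →ₜ* Circle) (Φ : CMType L) : Prop :=
  ∃ (e : InfinitePlace L → ℤ) (he : ∀ w, e w ≠ 0), HasInfinityType L ψ e ∧ cmTypeOf L e he = Φ

omit [IsCMField L] in
/-- A character with ∞-type `e` has weight `weight e`. [folklore] -/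
theorem hasWeight_of_hasInfinityType {ψ : IdeleClassGroup L →ₜ* Circle} {e : InfinitePlace L → ℤ}
    (he : HasInfinityType L ψ e) : HasWeight L ψ (weight e) :=
  ⟨e, he, rfl⟩

/-- A character with zero-free ∞-type `e` has CM type `cmTypeOf e`. [folklore] -/
theorem hasCMType_cmTypeOf {ψ : IdeleClassGroup L →ₜ* Circle} {e : InfinitePlace L → ℤ}
    (he : HasInfinityType L ψ e) (hne : ∀ w, e w ≠ 0) : HasCMType L ψ (cmTypeOf L e hne) :=
  ⟨e, hne, he, rfl⟩

/-- **The weight is unique** ("a unique tuple `𝚠_μ`"). [cite: Liu2021, Remark 4.2] -/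
theorem HasWeight.unique {ψ : IdeleClassGroup L →ₜ* Circle} {𝔴 𝔴' : InfinitePlace L → ℕ}
    (h : HasWeight L ψ 𝔴) (h' : HasWeight L ψ 𝔴') : 𝔴 = 𝔴' := by
  obtain ⟨e, he, rfl⟩ := h
  obtain ⟨e', he', rfl⟩ := h'
  rw [hasInfinityType_unique he he']

/-- **The CM type is unique** ("if `𝚠_μ` does not contain `0`, then `Φ_μ` is also unique").
[cite: Liu2021, Remark 4.2] -/
theorem HasCMType.unique {ψ : IdeleClassGroup L →ₜ* Circle} {Φ Φ' : CMType L}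
    (h : HasCMType L ψ Φ) (h' : HasCMType L ψ Φ') : Φ = Φ' := by
  obtain ⟨e, hne, he, rfl⟩ := h
  obtain ⟨e', hne', he', rfl⟩ := h'
  obtain rfl := hasInfinityType_unique he he'
  rfl

/-- The weight of a character with a CM type is zero-free. [folklore] -/
theorem HasCMType.weight_ne_zero {ψ : IdeleClassGroup L →ₜ* Circle} {Φ : CMType L}
    (h : HasCMType L ψ Φ) {𝔴 : InfinitePlace L → ℕ} (h𝔴 : HasWeight L ψ 𝔴) (w : InfinitePlace L) :
    𝔴 w ≠ 0 := by
  obtain ⟨e, hne, he, rfl⟩ := h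
  obtain ⟨e', he', rfl⟩ := h𝔴
  obtain rfl := hasInfinityType_unique he he'
  rw [weight_apply]
  exact Int.natAbs_ne_zero.2 (hne w)

/-- A conjugate symplectic character has odd weights. [cite: Liu2021, Remark 4.2] -/
theorem IsConjugateSymplectic.odd_weight {ψ : IdeleClassGroup L →ₜ* Circle}
    (hψ : IsConjugateSymplectic L ψ) {𝔴 : InfinitePlace L → ℕ} (h : HasWeight L ψ 𝔴)
    (w : InfinitePlace L) : Odd (𝔴 w) := by
  obtain ⟨e, he, rfl⟩ := h
  exact Int.natAbs_odd.2 (hψ.odd he w)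

/-- A conjugate orthogonal character has even weights. [cite: Liu2021, Remark 4.2] -/
theorem IsConjugateOrthogonal.even_weight {ψ : IdeleClassGroup L →ₜ* Circle}
    (hψ : IsConjugateOrthogonal L ψ) {𝔴 : InfinitePlace L → ℕ} (h : HasWeight L ψ 𝔴)
    (w : InfinitePlace L) : Even (𝔴 w) := by
  obtain ⟨e, he, rfl⟩ := h
  exact Int.natAbs_even.2 (hψ.even he w)

/-- A conjugate symplectic character with an ∞-type has a CM type ("there exist a CM type `Φ_μ` …").
[cite: Liu2021, Remark 4.2] -/
theorem IsConjugateSymplectic.exists_hasCMType {ψ : IdeleClassGroup L →ₜ* Circle}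
    (hψ : IsConjugateSymplectic L ψ) {e : InfinitePlace L → ℤ} (he : HasInfinityType L ψ e) :
    ∃ Φ : CMType L, HasCMType L ψ Φ :=
  ⟨cmTypeOf L e (hψ.ne_zero he), hasCMType_cmTypeOf he _⟩

/-! ## Existence: conjugate symplectic characters of weight one with prescribed CM type -/

variable (L) in
open scoped Classical in
/-- The weight-one ∞-type attached to a CM type `Φ`: `−1` at `w` if the distinguished embedding
`w.embedding` lies in `Φ`, `+1` otherwise (so that the exponent is `−1` exactly in the coordinates
`φ ∈ Φ`). [cite: Liu2021, Remark 4.2] -/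
def weightOneType (Φ : CMType L) : InfinitePlace L → ℤ :=
  fun w => if w.embedding ∈ Φ.1 then -1 else 1

omit [NumberField L] [IsCMField L] in
/-- `weightOneType Φ` is odd everywhere. [folklore] -/
theorem weightOneType_modEq (Φ : CMType L) (w : InfinitePlace L) : weightOneType L Φ w ≡ 1 [ZMOD 2] := by
  unfold weightOneType
  split_ifs <;> decide

omit [NumberField L] [IsCMField L] in
/-- `weightOneType Φ` is zero-free. [folklore] -/
theorem weightOneType_ne_zero (Φ : CMType L) (w : InfinitePlace L) : weightOneType L Φ w ≠ 0 := by
  unfold weightOneType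
  split_ifs <;> decide

omit [NumberField L] [IsCMField L] in
/-- `weightOneType Φ` has weight one. [folklore] -/
theorem weight_weightOneType (Φ : CMType L) : weight (weightOneType L Φ) = 1 := by
  funext w
  rw [weight_apply, Pi.one_apply]
  unfold weightOneType
  split_ifs <;> rfl

/-- The CM type of `weightOneType Φ` is `Φ`: membership. [folklore] -/
theorem mem_cmTypeOf_weightOneType_iff (Φ : CMType L) (φ : L →+* ℂ) :
    φ ∈ (cmTypeOf L (weightOneType L Φ) (weightOneType_ne_zero Φ)).1 ↔ φ ∈ Φ.1 := by
  obtain ⟨w, rfl | rfl⟩ : ∃ w : InfinitePlace L,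
      φ = w.embedding ∨ φ = ComplexEmbedding.conjugate w.embedding :=
    ⟨InfinitePlace.mk φ, (embedding_mk_eq φ).imp Eq.symm fun h => by
      rw [h]; exact (ComplexEmbedding.involutive_conjugate L φ).symm⟩
  · rw [embedding_mem_cmTypeOf_iff]
    unfold weightOneType
    split_ifs with hmem <;> simp [hmem]
  · rw [conjugate_embedding_mem_cmTypeOf_iff, Φ.2 (ComplexEmbedding.conjugate w.embedding),
      ComplexEmbedding.involutive_conjugate L w.embedding]
    unfold weightOneType
    split_ifs with hmem <;> simp [hmem]

/-- **The CM type of `weightOneType Φ` is `Φ`.** [folklore] -/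
theorem cmTypeOf_weightOneType (Φ : CMType L) :
    cmTypeOf L (weightOneType L Φ) (weightOneType_ne_zero Φ) = Φ :=
  Subtype.ext (Set.ext fun φ => mem_cmTypeOf_weightOneType_iff Φ φ)

/-- **Existence with prescribed ∞-type**: for every CM type `Φ` there is a conjugate symplectic
`ψ : C_L →ₜ* S¹` of ∞-type `weightOneType Φ` (`exists_ideleClassChar_of_isCMField_odd`, `m = 1`).
[cite: WeilBNT1967, Ch. VII §3] -/
theorem exists_isConjugateSymplectic_hasInfinityType (Φ : CMType L) :
    ∃ ψ : IdeleClassGroup L →ₜ* Circle,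
      IsConjugateSymplectic L ψ ∧ HasInfinityType L ψ (weightOneType L Φ) := by
  obtain ⟨ψ, he, hres⟩ :=
    exists_ideleClassChar_of_isCMField_odd L odd_one (weightOneType L Φ) (weightOneType_modEq Φ)
  exact ⟨ψ, hres, he⟩

/-- **Conjugate symplectic characters of weight one with prescribed CM type exist**: for every CM type
`Φ` of the CM field `L` there is a continuous unitary character `ψ : C_L →ₜ* S¹` which is conjugate
symplectic (`ψ ∘ ι = ε_{L/L⁺}`), of weight one, and of CM type `Φ` — the objects Liu's §4 quantifies
over ("conjugate symplectic automorphic characters of `𝔸_E^×` of weight one", with `Φ_μ = Φ`).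
[cite: Liu2021, Def. 4.3; WeilBNT1967, Ch. VII §3] -/
theorem exists_isConjugateSymplectic_hasCMType (Φ : CMType L) :
    ∃ ψ : IdeleClassGroup L →ₜ* Circle,
      IsConjugateSymplectic L ψ ∧ HasWeight L ψ 1 ∧ HasCMType L ψ Φ := by
  obtain ⟨ψ, hψ, he⟩ := exists_isConjugateSymplectic_hasInfinityType Φ
  exact ⟨ψ, hψ, ⟨_, he, weight_weightOneType Φ⟩, ⟨_, weightOneType_ne_zero Φ, he, cmTypeOf_weightOneType Φ⟩⟩

end ConjugateSelfDual

end IdeleClassGroup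

end Literature.NumberTheory.Automorphic

end
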